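import Literature.NumberTheory.EllipticCurves.BSDAnalyticRankGoldfeldProofs
import Literature.NumberTheory.EllipticCurves.AnalyticRankModularityProofs
import HarnessLib

/-!
# bsd.S35 (Goldfeld) from modularity in its weakest usable forms

`Literature.NumberTheory.EllipticCurves.BSDAnalyticRankGoldfeldProofs` proves the named fact
`Literature.analyticRank_eq_of_isEquivalent_prod W` (Goldfeld 1982; K. Conrad, *Partial Euler products
on the critical line*, Canad. J. Math. 57 (2005), Thm. 1.1 and Cor. 5.7) for every elliptic
`W / ℚ` in globally minimal form **whose `L`-series has an entire continuation**
(`analyticRank_eq_of_isEquivalent_prod_of_hasEntireLFunction`), and hence for every `W` from the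
named fact `WeierstrassCurve.hasEntireLFunction_rat`. Conrad (p. 281, after the proof of
Cor. 5.7) notes that the printed proof "tacitly appeals to the elliptic modularity theorem to get
holomorphy of `L(E, s)` at `s = 1`"; this sibling file threads that appeal through the tree's
reduction of `hasEntireLFunction_rat` to modular forms
(`Literature.NumberTheory.EllipticCurves.AnalyticRankModularityProofs`), so that the residual
hypothesis of bsd.S35 is stated in Lean in exactly the two shapes in which it is available:

* `Literature.NumberTheory.EllipticCurves.analyticRank_eq_of_isEquivalent_prod_of_cuspCoeff_eq` — **curve by curve**: if the
  Dirichlet coefficients `aₙ(W)` are the Fourier coefficients of *some* weight-`2` cusp form on an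
  arithmetic group with strict width `1` at `∞` (e.g. `Γ₀(N)`, `Γ₁(N)`; no newform, eigenform or
  level condition), then Goldfeld's implication holds for `W` — unconditionally, by Hecke's
  analytic continuation (`WeierstrassCurve.hasEntireLFunction_of_cuspCoeff_eq`: Hecke 1936,
  Diamond–Shurman Thm. 5.10.2, Rankin 1977 Thm. 4.5.2) and the Goldfeld–Conrad analysis;
* `Literature.NumberTheory.EllipticCurves.analyticRank_eq_of_isEquivalent_prod_of_exists_isNewformOf` — **for all curves** from the
  existence half `Literature.NumberTheory.EllipticCurves.ModularForms.exists_isNewformOf` of the modularity theorem alone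
  (Diamond–Shurman Thm. 8.8.3; Breuil–Conrad–Diamond–Taylor 2001, Thm. A), the root named fact
  on which the discharge `analyticRank_eq_of_isEquivalent_prod_holds` waits:
  `analyticRank_eq_of_isEquivalent_prod_holds W` will be
  `analyticRank_eq_of_isEquivalent_prod_of_exists_isNewformOf exists_isNewformOf_holds W`.

Both are compositions of theorems of the tree; no new analytic content.

## References

* D. Goldfeld, *Sur les produits partiels eulériens attachés aux courbes elliptiques*,
  C. R. Acad. Sci. Paris Sér. I Math. 294 (1982), 471–474.
* K. Conrad, *Partial Euler products on the critical line*, Canad. J. Math. 57 (2005), 267–297,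
  Thm. 1.1, Thm. 5.3, Cor. 5.7 and p. 281.
* F. Diamond, J. Shurman, *A first course in modular forms*, GTM 228, Springer 2005,
  Thm. 5.10.2 and Thm. 8.8.3.
* C. Breuil, B. Conrad, F. Diamond, R. Taylor, *On the modularity of elliptic curves over `ℚ`*,
  J. Amer. Math. Soc. 14 (2001), 843–939, Thm. A.
-/

noncomputable section

open scoped MatrixGroups

open Literature.NumberTheory.EllipticCurves.ModularForms

namespace Literature.NumberTheory.EllipticCurves

/-- **bsd.S35 for a curve with a modular `q`-expansion** (Goldfeld 1982; Conrad 2005, Thm. 1.1 /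
Cor. 5.7, with the modularity input made explicit and minimal). Let `W / ℚ` be elliptic, in
globally minimal form, and suppose `aₙ(W) = aₙ(f)` for all `n` for some cusp form `f ∈ S₂(Γ)`,
`Γ ≤ GL₂(ℝ)` arithmetic with strict width `1` at `∞` (e.g. `Γ₀(N)`, `Γ₁(N)`). If
`∏_{p ≤ x} N_p/p ∼ C (log x)^r` (`C > 0`, `r ∈ ℕ`), then `W.analyticRank = r` and `L(E, s) ≠ 0`
for `Re s > 1`. Proof: `L(W, s) = L(f, s)` is entire by Hecke
(`WeierstrassCurve.hasEntireLFunction_of_cuspCoeff_eq`), then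
`analyticRank_eq_of_isEquivalent_prod_of_hasEntireLFunction`.
[cite: Conrad2005PartialEuler, Cor. 5.7 and p. 281] [cite: DiamondShurman2005, Thm. 5.10.2] -/
theorem analyticRank_eq_of_isEquivalent_prod_of_cuspCoeff_eq {Γ : Subgroup (GL (Fin 2) ℝ)}
    [Γ.IsArithmetic] (hΓ : Γ.strictWidthInfty = 1) (W : WeierstrassCurve ℚ) [W.IsElliptic]
    [W.IsGloballyMinimal] (f : CuspForm Γ 2)
    (hf : ∀ n : ℕ, cuspCoeff f n = (W.LFunction n : ℂ)) :
    analyticRank_eq_of_isEquivalent_prod W :=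
  analyticRank_eq_of_isEquivalent_prod_of_hasEntireLFunction W
    (W.hasEntireLFunction_of_cuspCoeff_eq hΓ f hf)

/-- **bsd.S35 from the Modularity Theorem, Version `L`** (Goldfeld 1982; Conrad 2005, Cor. 5.7:
"Apply Corollary 4.11 and Theorem 5.3 to `L(s) = L(E, s + 1/2)`", the holomorphy of `L(E, s)` at
`s = 1` coming from modularity, p. 281). From the existence half
`Literature.NumberTheory.EllipticCurves.ModularForms.exists_isNewformOf` of the modularity theorem (every elliptic `W / ℚ` has a
newform `f ∈ S₂(Γ₀(N_W))` with `aₙ(f) = aₙ(W)`; Diamond–Shurman Thm. 8.8.3, proved by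
Breuil–Conrad–Diamond–Taylor 2001, Thm. A) the named fact
`Literature.analyticRank_eq_of_isEquivalent_prod W` holds for every elliptic `W / ℚ` in globally minimal
form. This is the complete printed proof; only `exists_isNewformOf` itself is not formalised.
[cite: Conrad2005PartialEuler, Cor. 5.7 and p. 281] [cite: DiamondShurman2005, Thm. 8.8.3]
[cite: Goldfeld1982, Théorème (p. 471)] -/
theorem analyticRank_eq_of_isEquivalent_prod_of_exists_isNewformOf
    (hmod : Literature.NumberTheory.EllipticCurves.ModularForms.exists_isNewformOf) (W : WeierstrassCurve ℚ) [W.IsElliptic]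
    [W.IsGloballyMinimal] : analyticRank_eq_of_isEquivalent_prod W :=
  analyticRank_eq_of_isEquivalent_prod_of_hasEntireLFunction_rat
    (WeierstrassCurve.hasEntireLFunction_rat_of_exists_isNewformOf hmod) W

/-- The same from the modularity theorem with uniqueness, `existsUnique_isNewformOf`
(Diamond–Shurman Thm. 8.8.1/8.8.3 with Carayol's level; equivalent to `exists_isNewformOf` by
`existsUnique_isNewformOf_iff`). [cite: DiamondShurman2005, Thm. 8.8.3] -/
theorem analyticRank_eq_of_isEquivalent_prod_of_existsUnique_isNewformOf
    (hmod : Literature.NumberTheory.EllipticCurves.ModularForms.existsUnique_isNewformOf) (W : WeierstrassCurve ℚ) [W.IsElliptic]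
    [W.IsGloballyMinimal] : analyticRank_eq_of_isEquivalent_prod W :=
  analyticRank_eq_of_isEquivalent_prod_of_exists_isNewformOf
    (existsUnique_isNewformOf_iff.mp hmod) W

end Literature.NumberTheory.EllipticCurves

end
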